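import Summits.BirchSwinnertonDyer.BirchSwinnertonDyer.Theorems.ThetaPartnerAtTwoSignedControlAtTwoPlusHondaTransportNonDiv
import HarnessLib

/-!
# Model transport of the PRIMAL Honda data (levels, the three relations, generation with a multiplier) from Mathlib's `ℚ_[p]`
# (every embedding `ι`) to the completion `ℚ_v = v.adicCompletion ℚ` (the chosen embedding `closureEmb ℚ_v`) (route `PrintX8VS` /
# `PrintX8`, support item `InputHondaSystem` = stmt-BirchSwinnertonDyer-20413, named fact `Sprung2012.thm22_exists_isHondaSystem`;
# file 16 of the local series — the pattern of the tree's `…PlusHondaTransport` for the clause list of `Sprung2012.IsHondaSystem`)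

HONEST FRAMING (desk `pub/bsd-wall/bsd-inputs`, seat `bsd-inputs-honda-p1`, D-0154 (2) INPUTS): THEOREMS ONLY — no definition, no
named fact, no instance, no `sorry`; Galois bookkeeping (engine: `Theorems.SignedEC.modelMap_*`); closes nothing by itself; BSD is
not proved by any of this.

References: [SerreGaloisCohomology1997] J.-P. Serre, *Galois Cohomology*, II.§1.1; [Kobayashi2003] S. Kobayashi, Invent. Math. 152
(2003), Def. 1.1; [Sprung2012] F. Sprung, J. Number Theory 132 (2012), Thm. 2.2; [MilneFT2022] J. S. Milne, *Fields and Galois Theory*,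
Ch. 6.
-/

set_option autoImplicit false
-- the Theorems namespace of this sub repeats the summit name by design (D-0017 nested layout)
set_option linter.dupNamespace false

noncomputable section

open scoped Classical NumberField

open NumberField IsDedekindDomain WeierstrassCurve Literature.NumberTheory.EllipticCurves
  Literature.NumberTheory.GaloisRepresentations Literature.NumberTheory.EllipticCurves.Kobayashi2003

universe u

namespace Summit.BirchSwinnertonDyer.BirchSwinnertonDyer.Theorems

namespace SprungHonda

open Summit.BirchSwinnertonDyer.BirchSwinnertonDyer.Theorems.SignedEC

section Generic

variable {K : Type u} [Field K] {E : Type u} [Field E] [Algebra K E] {E' : Type u} [Field E'] [Algebra K E']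
  (Φ : AlgebraicClosure E ≃ₐ[K] AlgebraicClosure E') (φ : E ≃+* E')
  (hf : ∀ y : E, Φ (algebraMap E (AlgebraicClosure E) y) = algebraMap E' (AlgebraicClosure E') (φ y))
  (ι : AlgebraicClosure K →ₐ[K] AlgebraicClosure E) (ι' : AlgebraicClosure K →ₐ[K] AlgebraicClosure E')
  (hcompat : ∀ z : AlgebraicClosure K, ι' z = Φ (ι z))
  (W : WeierstrassCurve K) (T : localPoints W E →+ localPoints W E')
  (hT : ∀ P : localPoints W E, T P =
    WeierstrassCurve.Affine.Point.map (W' := W) (Φ : AlgebraicClosure E →ₐ[K] AlgebraicClosure E')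
      (show (W.baseChange (AlgebraicClosure E)).toAffine.Point from P))
  {p : ℕ} [Fact p.Prime] (κ : ZpExtension K p)

include hf hcompat hT in
/-- **The primal Honda data moves along an isomorphism of models**: levels, the three trace relations of `IsHondaSystem`, and the
generation clauses with a multiplier `N`, for `(cneg, c)` at (`E`, `ι`), yield the same for `(T cneg, T ∘ c)` at (`E'`, `ι'`).
[cite: SerreGaloisCohomology1997, II.§1.1] [cite: Kobayashi2003, Def. 1.1] -/
theorem primalHonda_modelTransport (ap : ℤ)
    (h : ∃ (cneg : localPoints W E) (c : ℕ → localPoints W E) (N : ℕ), N.Coprime p ∧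
      cneg ∈ localLayerPointsOfEmb κ ι W 0 ∧ (∀ n, c n ∈ localLayerPointsOfEmb κ ι W n) ∧
      c 0 = (ap - 2) • cneg ∧
      localTraceOfEmb κ ι W 0 1 (c 1) = ap • c 0 - ((p : ℤ) - 1) • cneg ∧
      (∀ n : ℕ, 1 ≤ n → localTraceOfEmb κ ι W n (n + 1) (c (n + 1)) = ap • c n - c (n - 1)) ∧
      (∀ m : ℕ, 1 ≤ m → ∀ P ∈ localLayerPointsOfEmb κ ι W m,
        ∃ B ∈ AddSubgroup.closure (Set.range fun σ : Field.absoluteGaloisGroup E ↦ σ • c m),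
          ∃ P' ∈ localLayerPointsOfEmb κ ι W (m - 1), ∃ R ∈ localLayerPointsOfEmb κ ι W m, N • P = B + P' + p • R) ∧
      (∀ P ∈ localLayerPointsOfEmb κ ι W 0, ∃ u : ℤ, ∃ R ∈ localLayerPointsOfEmb κ ι W 0, N • P = u • cneg + p • R)) :
    ∃ (cneg : localPoints W E') (c : ℕ → localPoints W E') (N : ℕ), N.Coprime p ∧
      cneg ∈ localLayerPointsOfEmb κ ι' W 0 ∧ (∀ n, c n ∈ localLayerPointsOfEmb κ ι' W n) ∧
      c 0 = (ap - 2) • cneg ∧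
      localTraceOfEmb κ ι' W 0 1 (c 1) = ap • c 0 - ((p : ℤ) - 1) • cneg ∧
      (∀ n : ℕ, 1 ≤ n → localTraceOfEmb κ ι' W n (n + 1) (c (n + 1)) = ap • c n - c (n - 1)) ∧
      (∀ m : ℕ, 1 ≤ m → ∀ P ∈ localLayerPointsOfEmb κ ι' W m,
        ∃ B ∈ AddSubgroup.closure (Set.range fun σ : Field.absoluteGaloisGroup E' ↦ σ • c m),
          ∃ P' ∈ localLayerPointsOfEmb κ ι' W (m - 1), ∃ R ∈ localLayerPointsOfEmb κ ι' W m, N • P = B + P' + p • R) ∧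
      (∀ P ∈ localLayerPointsOfEmb κ ι' W 0, ∃ u : ℤ, ∃ R ∈ localLayerPointsOfEmb κ ι' W 0, N • P = u • cneg + p • R) := by
  have hmem := modelMap_mem_localLayerPointsOfEmb_iff Φ φ hf ι ι' hcompat W T hT κ
  have htr := fun m k {P : localPoints W E} (hP : P ∈ localLayerPointsOfEmb κ ι W k) ↦
    modelMap_localTraceOfEmb Φ φ hf ι ι' hcompat W T hT κ m k hP
  obtain ⟨cneg, c, N, hN, hcneg, hc, hR0, hR1, hRn, hgen, hgen0⟩ := h
  refine ⟨T cneg, fun n ↦ T (c n), N, hN, (hmem 0 _).mpr hcneg, fun n ↦ (hmem n _).mpr (hc n), ?_, ?_, ?_, ?_, ?_⟩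
  · dsimp only
    rw [hR0, map_zsmul]
  · dsimp only
    rw [← htr 0 1 (hc 1), hR1, map_sub, map_zsmul, map_zsmul]
  · intro n hn
    dsimp only
    rw [← htr n (n + 1) (hc (n + 1)), hRn n hn, map_sub, map_zsmul]
  · intro m hm P' hP'
    dsimp only
    obtain ⟨P, rfl⟩ := modelMap_surjective Φ W T hT P'
    obtain ⟨B, hB, P₁, hP₁, R, hR, hPe⟩ := hgen m hm P ((hmem m P).mp hP')
    refine ⟨T B, ?_, T P₁, (hmem _ _).mpr hP₁, T R, (hmem _ _).mpr hR, by rw [← map_nsmul, hPe, map_add, map_add, map_nsmul]⟩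
    rw [← map_modelMap_closure_orbit Φ φ hf W T hT]
    exact AddSubgroup.mem_map_of_mem T hB
  · intro P' hP'
    obtain ⟨P, rfl⟩ := modelMap_surjective Φ W T hT P'
    obtain ⟨u, R, hR, hPe⟩ := hgen0 P ((hmem 0 P).mp hP')
    exact ⟨u, T R, (hmem _ _).mpr hR, by rw [← map_nsmul, hPe, map_add, map_zsmul, map_nsmul]⟩

end Generic

/-! ## `K = ℚ`: from Mathlib's `ℚ_[p]` (every embedding) to `ℚ_v` (the chosen embedding) -/

section Padic

/-- **Primal Honda data over (`ℚ_[p]`, every `ι`) ⟹ over (`ℚ_v`, `closureEmb`)** at the place `v ∋ p`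
(tree `SignedEC.exists_model_padic_adicCompletion`: `Φ : ℚ̄_p ≃ ℚ̄_v` over `ℚ_[p] ≃ ℚ_v`, `closureEmb = Φ ∘ ι`).
[cite: SerreGaloisCohomology1997, II.§1.1] [cite: Kobayashi2003, Def. 1.1] [cite: MilneFT2022, Ch. 6] -/
theorem primalHonda_adicCompletion_of_padic {p : ℕ} [Fact p.Prime] (W : WeierstrassCurve ℚ) (κ : ZpExtension ℚ p) (ap : ℤ)
    (v : HeightOneSpectrum (𝓞 ℚ)) (hv : (p : 𝓞 ℚ) ∈ v.asIdeal)
    (h : ∀ ι : AlgebraicClosure ℚ →ₐ[ℚ] AlgebraicClosure ℚ_[p],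
      ∃ (cneg : localPoints W ℚ_[p]) (c : ℕ → localPoints W ℚ_[p]) (N : ℕ), N.Coprime p ∧
      cneg ∈ localLayerPointsOfEmb κ ι W 0 ∧ (∀ n, c n ∈ localLayerPointsOfEmb κ ι W n) ∧
      c 0 = (ap - 2) • cneg ∧
      localTraceOfEmb κ ι W 0 1 (c 1) = ap • c 0 - ((p : ℤ) - 1) • cneg ∧
      (∀ n : ℕ, 1 ≤ n → localTraceOfEmb κ ι W n (n + 1) (c (n + 1)) = ap • c n - c (n - 1)) ∧
      (∀ m : ℕ, 1 ≤ m → ∀ P ∈ localLayerPointsOfEmb κ ι W m,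
        ∃ B ∈ AddSubgroup.closure (Set.range fun σ : Field.absoluteGaloisGroup ℚ_[p] ↦ σ • c m),
          ∃ P' ∈ localLayerPointsOfEmb κ ι W (m - 1), ∃ R ∈ localLayerPointsOfEmb κ ι W m, N • P = B + P' + p • R) ∧
      (∀ P ∈ localLayerPointsOfEmb κ ι W 0, ∃ u : ℤ, ∃ R ∈ localLayerPointsOfEmb κ ι W 0, N • P = u • cneg + p • R)) :
    ∃ (cneg : localPoints W (v.adicCompletion ℚ)) (c : ℕ → localPoints W (v.adicCompletion ℚ)) (N : ℕ), N.Coprime p ∧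
      cneg ∈ localLayerPointsOfEmb κ (closureEmb (K := ℚ) (v.adicCompletion ℚ)) W 0 ∧
      (∀ n, c n ∈ localLayerPointsOfEmb κ (closureEmb (K := ℚ) (v.adicCompletion ℚ)) W n) ∧
      c 0 = (ap - 2) • cneg ∧
      localTraceOfEmb κ (closureEmb (K := ℚ) (v.adicCompletion ℚ)) W 0 1 (c 1) = ap • c 0 - ((p : ℤ) - 1) • cneg ∧
      (∀ n : ℕ, 1 ≤ n → localTraceOfEmb κ (closureEmb (K := ℚ) (v.adicCompletion ℚ)) W n (n + 1) (c (n + 1)) =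
        ap • c n - c (n - 1)) ∧
      (∀ m : ℕ, 1 ≤ m → ∀ P ∈ localLayerPointsOfEmb κ (closureEmb (K := ℚ) (v.adicCompletion ℚ)) W m,
        ∃ B ∈ AddSubgroup.closure (Set.range fun σ : Field.absoluteGaloisGroup (v.adicCompletion ℚ) ↦ σ • c m),
          ∃ P' ∈ localLayerPointsOfEmb κ (closureEmb (K := ℚ) (v.adicCompletion ℚ)) W (m - 1),
          ∃ R ∈ localLayerPointsOfEmb κ (closureEmb (K := ℚ) (v.adicCompletion ℚ)) W m, N • P = B + P' + p • R) ∧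
      (∀ P ∈ localLayerPointsOfEmb κ (closureEmb (K := ℚ) (v.adicCompletion ℚ)) W 0,
        ∃ u : ℤ, ∃ R ∈ localLayerPointsOfEmb κ (closureEmb (K := ℚ) (v.adicCompletion ℚ)) W 0, N • P = u • cneg + p • R) := by
  obtain ⟨Φ, φ, hf, ι, hcompat⟩ := exists_model_padic_adicCompletion (p := p) hv
  exact primalHonda_modelTransport Φ φ hf ι (closureEmb (K := ℚ) (v.adicCompletion ℚ)) hcompat W
    (show localPoints W ℚ_[p] →+ localPoints W (v.adicCompletion ℚ) from
      WeierstrassCurve.Affine.Point.map (W' := W) (Φ : AlgebraicClosure ℚ_[p] →ₐ[ℚ] AlgebraicClosure (v.adicCompletion ℚ)))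
    (fun _ ↦ rfl) κ ap (h ι)

end Padic

end SprungHonda

end Summit.BirchSwinnertonDyer.BirchSwinnertonDyer.Theorems

end
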